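import Mathlib
import Literature.Computability.AlgebraicComplexity.DepthThreeRankBound
import Summits.ValiantsHypothesis.ValiantsHypothesis.Theorems.MonotoneRestorationMixingScaleOrbitStructure
import Summits.ValiantsHypothesis.ValiantsHypothesis.Theorems.MonotoneRestorationMixingScaleOrbitClassSums
import Summits.ValiantsHypothesis.ValiantsHypothesis.Theorems.MonotoneRestorationMixingScaleGrowingFanin
import Summits.ValiantsHypothesis.ValiantsHypothesis.Theorems.MonotoneRestorationOrbitRestorationQPSigmaKThresholds
import Summits.ValiantsHypothesis.ValiantsHypothesis.Theorems.MonotoneRestorationOrbitRestorationQPGoodScale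
import HarnessLib

/-!
# M4c of the line `mixing-scale`, III: THEOREM S′ — the level structure at a POLYNOMIAL threshold (ORBIT currency)

Route MonotoneRestoration, crux `OrbitRestorationQP` (stmt-ValiantsHypothesis-18293), line `mixing-scale` (val-idea-12, skeleton
`Cruxes/OrbitRestorationQP/Lines/mixing_scale.lean`), registered stub **M4c**
`stub_polyScaleStructure : depthThree_rankBound → AlmostInvariantTerms → OrbitClassSums → EssStableAlt → SpanOneUAlt → ∀ c, PolyScaleStructure c`,
landed here BY NAME in namespace `Summit.ValiantsHypothesis.ValiantsHypothesis.Theorems.OrbitRestorationQPMixingScale` over the Theorems-side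
vocabulary `…MixingScaleDefs.lean` (R48 of director-valiant g11: ms1 = M4c).

THE ARGUMENT.  Given `A(c)·(k+1)^7·(log₂ n + 1) ≤ n` and a matrix-symmetric `f` written with `k` scaled products of `≤ n^c + c` affine
forms: clean it (`exists_cleanRep`, `m ≤ k` terms); label every term by the least element of its ORBIT-LINKED CLASS (`orbitRep`); by M2
(`AlmostInvariantTerms`, regime `8 < n`, `m³ + 2 ≤ n`) an orbit-close pair is at plain rank distance `≤ Rb + 28·Rb`, so a class has plain
diameter `Θ := (m − 1)·29·Rb` (`RankClustering.dist_le_of_linked`); by M3 (`OrbitClassSums`) every even renaming fixes every class sum.  This is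
an `OrbitDatum` (part I); its side conditions `Hyps c` — `4mD < C(n,c+2)` (`SigmaKThresholds.choose_gt_of_le` at `4k`), `4(c+2) ≤ n`,
`c + 7 ≤ n`, `4m(1 + m²Θ) + 8 ≤ n` (`rb_le_rbBound`: `Rb ≤ 12k²(2c+2)(log₂ n+1)`, so the dimension is `≤ (1392(2c+2) + 12)(k+1)^7(log₂ n+1)`) —
all follow from the polynomial threshold, and part II's `structure_level` (M4a + M4b + sign characters + global untwisting) gives
`f = Σ_a u_a · Π Lin_a · Q_a(U)` with FULLY matrix-symmetric affine products; padding to `Fin k` as in the landed `SigmaPiSigmaK.level_data`.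

The hypotheses `EssStableAlt` and `SpanOneUAlt` of the registered signature are LANDED theorems (`essStableAlt` p602355, `spanOneUAlt`
p602629) used inside part II; they are carried here unused, exactly as registered.  Proved modulo the named fact `depthThree_rankBound` and
M2's conclusion `AlmostInvariantTerms` (landed as `stub_almostInvariantTerms` from the Literature fact `alternatingProductMixing`), both BY
NAME as hypotheses.  Honest framing: this closes the line's load-bearing stub; the NEW RUNG `GrowingFaninRestoration` then follows from
{`alternatingProductMixing`, `depthThree_rankBound`, A₁ = `PiSigmaValue`} by the landed M5 `growingFanin` — the rung
`ProductDepthRestorationQP (fun _ => 1)` itself only through the declared residual; VP ≠ VNP is NOT proved or moved.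
[cite: KarninShpilka2009, §3; SaxenaSeshadhri2013, Theorem 5]
-/

noncomputable section

open MvPolynomial Equiv Literature.Computability.AlgebraicComplexity

-- `Summit.ValiantsHypothesis.ValiantsHypothesis.…` is the tree's single-conjunct layout (Sub = Summit).
set_option linter.dupNamespace false

namespace Summit.ValiantsHypothesis.ValiantsHypothesis.Theorems.OrbitRestorationQPMixingScale

open RankDistance LinNL LinearSubalgebra ProductAction LevelRep LevelStructure SigmaKThresholds

/-! ### The orbit-class labelling of a clean representation -/
section Labelling

variable {n D : ℕ} {f : MvPolynomial (Fin n × Fin n) ℂ}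

/-- Equivalent terms have the same orbit-linked class. [folklore] -/
theorem orbitClass_eq_of_eqvGen (R : CleanRep f D) {i j : Fin R.m} (h : Relation.EqvGen (OrbitClose R) i j) :
    orbitClass R i = orbitClass R j := by
  ext l
  rw [mem_orbitClass_iff, mem_orbitClass_iff]
  exact ⟨fun hl => Relation.EqvGen.trans _ _ _ (Relation.EqvGen.symm _ _ h) hl, fun hl => Relation.EqvGen.trans _ _ _ h hl⟩

/-- The REPRESENTATIVE of the orbit-linked class of `i`: its least element. [folklore] -/
def orbitRep (R : CleanRep f D) (i : Fin R.m) : Fin R.m := (orbitClass R i).min' ⟨i, mem_orbitClass_self R i⟩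

/-- The representative lies in the class. [folklore] -/
theorem orbitRep_mem (R : CleanRep f D) (i : Fin R.m) : orbitRep R i ∈ orbitClass R i := Finset.min'_mem _ _

/-- Two terms have the same representative iff they are orbit-linked. [folklore] -/
theorem orbitRep_eq_iff (R : CleanRep f D) {i j : Fin R.m} : orbitRep R i = orbitRep R j ↔ Relation.EqvGen (OrbitClose R) i j := by
  constructor
  · intro h
    have hi := (mem_orbitClass_iff R).1 (orbitRep_mem R i)
    have hj := (mem_orbitClass_iff R).1 (orbitRep_mem R j)
    rw [h] at hi
    exact Relation.EqvGen.trans _ _ _ hi (Relation.EqvGen.symm _ _ hj)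
  · intro h
    have hcl := orbitClass_eq_of_eqvGen R h
    refine le_antisymm (Finset.min'_le _ _ ?_) (Finset.min'_le _ _ ?_)
    · rw [hcl]; exact orbitRep_mem R j
    · rw [← hcl]; exact orbitRep_mem R i

/-- The fibre of the representative labelling over the representative of `i` is the orbit-linked class of `i`. [folklore] -/
theorem filter_orbitRep_eq (R : CleanRep f D) (i : Fin R.m) :
    (Finset.univ.filter fun l => orbitRep R l = orbitRep R i) = orbitClass R i := by
  ext l
  simp only [Finset.mem_filter, Finset.mem_univ, true_and, mem_orbitClass_iff, orbitRep_eq_iff]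
  exact ⟨fun h => Relation.EqvGen.symm _ _ h, fun h => Relation.EqvGen.symm _ _ h⟩

/-- **Class sums of the representative labelling are fixed by even renamings** (M3). [folklore] -/
theorem clusterSum_orbitRep_fixed (hOC : OrbitClassSums) (hsym : ∀ σ τ : Perm (Fin n), mact σ τ f = f) (R : CleanRep f D)
    (b : Fin R.m) (σ τ : Perm (Fin n)) (hσ : Perm.sign σ = 1) (hτ : Perm.sign τ = 1) :
    mact σ τ (R.clusterSum (orbitRep R) b) = R.clusterSum (orbitRep R) b := by
  classical
  by_cases hb : ∃ i, orbitRep R i = b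
  · obtain ⟨i, rfl⟩ := hb
    rw [CleanRep.clusterSum, filter_orbitRep_eq]
    exact hOC n D f hsym R i σ τ hσ hτ
  · rw [R.clusterSum_eq_zero _ hb, map_zero]

/-- **An orbit-close pair is at plain rank distance `≤ 29·Rb`** (M2: the renamed partner is within `28·Rb` of itself). [folklore] -/
theorem rdist_le_of_orbitClose (hAI : AlmostInvariantTerms) (hsym : ∀ σ τ : Perm (Fin n), mact σ τ f = f) (R : CleanRep f D)
    (hn : 8 < n) (hm : R.m ^ 3 + 2 ≤ n) {i j : Fin R.m} (h : OrbitClose R i j) : rdist (R.L i) (R.L j) ≤ 29 * Rb R.m D := by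
  classical
  obtain ⟨σ, τ, hσ, hτ, hd⟩ := h
  have hj := hAI n D f hsym R hn hm j σ τ hσ hτ
  calc rdist (R.L i) (R.L j) ≤ rdist (R.L i) (act (mact σ τ) (R.L j)) + rdist (act (mact σ τ) (R.L j)) (R.L j) := rdist_triangle _ _ _
    _ ≤ Rb R.m D + 28 * Rb R.m D := Nat.add_le_add hd (by rw [rdist_comm]; exact hj)
    _ = 29 * Rb R.m D := by ring

/-- **Plain diameter of an orbit-linked class**: `≤ (m − 1)·29·Rb`. [folklore] -/
theorem rdist_le_of_eqvGen (hAI : AlmostInvariantTerms) (hsym : ∀ σ τ : Perm (Fin n), mact σ τ f = f) (R : CleanRep f D)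
    (hn : 8 < n) (hm : R.m ^ 3 + 2 ≤ n) {i j : Fin R.m} (h : Relation.EqvGen (OrbitClose R) i j) :
    rdist (R.L i) (R.L j) ≤ (R.m - 1) * (29 * Rb R.m D) := by
  classical
  -- the plain-closeness relation is symmetric, hence so is its reflexive-transitive closure
  have hsymm : ∀ a b : Fin R.m, rdist (R.L a) (R.L b) ≤ 29 * Rb R.m D → rdist (R.L b) (R.L a) ≤ 29 * Rb R.m D :=
    fun a b hab => by rw [rdist_comm]; exact hab
  have hrev : ∀ x y : Fin R.m, Relation.ReflTransGen (fun a b : Fin R.m => rdist (R.L a) (R.L b) ≤ 29 * Rb R.m D) x y →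
      Relation.ReflTransGen (fun a b : Fin R.m => rdist (R.L a) (R.L b) ≤ 29 * Rb R.m D) y x := by
    intro x y hxy
    induction hxy with
    | refl => exact Relation.ReflTransGen.refl
    | tail _ hbc ih => exact Relation.ReflTransGen.head (hsymm _ _ hbc) ih
  have hlink : Relation.ReflTransGen (fun a b : Fin R.m => rdist (R.L a) (R.L b) ≤ 29 * Rb R.m D) i j := by
    induction h with
    | rel x y hxy => exact Relation.ReflTransGen.single (rdist_le_of_orbitClose hAI hsym R hn hm hxy)
    | refl x => exact Relation.ReflTransGen.refl
    | symm x y _ ih => exact hrev _ _ ih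
    | trans x y z _ _ ih1 ih2 => exact ih1.trans ih2
  have := RankClustering.dist_le_of_linked (fun a b : Fin R.m => rdist (R.L a) (R.L b)) (fun a b l => rdist_triangle _ _ _)
    (fun a => rdist_self _) hlink
  rwa [Fintype.card_fin] at this

end Labelling

/-! ### Arithmetic of the polynomial threshold -/
section Arith

/-- `k ≤ (k+1)^7`, `k^6 ≤ (k+1)^7`, `k^3 ≤ (k+1)^7`, `1 ≤ (k+1)^7`. [folklore] -/
theorem pow7_bounds (k : ℕ) : 1 ≤ (k + 1) ^ 7 ∧ k ≤ (k + 1) ^ 7 ∧ k ^ 3 ≤ (k + 1) ^ 7 ∧ k ^ 6 ≤ (k + 1) ^ 7 := by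
  have h1 : 1 ≤ (k + 1) ^ 7 := Nat.one_le_pow _ _ (Nat.succ_pos k)
  have hk : k ≤ (k + 1) ^ 7 := (Nat.le_succ k).trans (Nat.le_self_pow (by norm_num) (k + 1))
  have h3 : k ^ 3 ≤ (k + 1) ^ 7 :=
    (Nat.pow_le_pow_left (Nat.le_succ k) 3).trans (Nat.pow_le_pow_right (Nat.succ_pos k) (by norm_num))
  have h6 : k ^ 6 ≤ (k + 1) ^ 7 :=
    (Nat.pow_le_pow_left (Nat.le_succ k) 6).trans (Nat.pow_le_pow_right (Nat.succ_pos k) (by norm_num))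
  exact ⟨h1, hk, h3, h6⟩

end Arith

/-! ### M4c -/

/-- **M4c — THEOREM S′: THE LEVEL STRUCTURE AT A POLYNOMIAL THRESHOLD** (registered stub `stub_polyScaleStructure` of the line
`mixing-scale`, verbatim signature).  Granting the Saxena–Seshadhri rank bound and M2's almost-invariance of terms (both BY NAME), and using
M3 (hypothesis) with the landed M4a/M4b inside `OrbitDatum.structure_level`: for `A(c)·(k+1)^7·(log₂ n + 1) ≤ n`, every matrix-symmetric `f`
given by `k` scaled products of `≤ n^c + c` affine forms is `Σ_{j<k} u_j · Π Lin_j · Q_j(U)` with fully matrix-symmetric affine products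
`Π Lin_j` of `≤ n^c + c` forms of degree `≤ 1` and univariate `Q_j`. [cite: KarninShpilka2009, §3; SaxenaSeshadhri2013, Theorem 5] -/
theorem stub_polyScaleStructure : depthThree_rankBound → AlmostInvariantTerms → OrbitClassSums → EssStableAlt → SpanOneUAlt →
    ∀ c : ℕ, PolyScaleStructure c := by
  intro _hRB hAI hOC _hES _hSU c
  classical
  -- the constant
  set M : ℕ := (c + 2).factorial * 2 ^ c * (c + 1) with hM
  refine ⟨1392 * (2 * c + 2) + 4 * M + 8 * c + 64, fun k n hn f hsym a L hL hcard hf => ?_⟩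
  set A : ℕ := 1392 * (2 * c + 2) + 4 * M + 8 * c + 64 with hA
  set D : ℕ := n ^ c + c with hD
  set P : ℕ := (k + 1) ^ 7 with hP
  set L1 : ℕ := Nat.log 2 n + 1 with hL1
  obtain ⟨hP1, hPk, hPk3, hPk6⟩ := pow7_bounds k
  have hL1' : 1 ≤ L1 := by rw [hL1]; omega
  have hPL : 1 ≤ P * L1 := Nat.one_le_iff_ne_zero.2 (Nat.mul_ne_zero (by omega) (by omega))
  have hPPL : P ≤ P * L1 := Nat.le_mul_of_pos_right P hL1'
  have hkPL : k ≤ P * L1 := hPk.trans hPPL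
  have hX : A * (P * L1) ≤ n := by rw [← mul_assoc]; exact hn
  -- generic domination: `t ≤ C·(P·L1) ≤ A·(P·L1) ≤ n` once `C ≤ A`; constants via `C = C·1 ≤ C·(P·L1)`
  have dom : ∀ {t C : ℕ}, t ≤ C * (P * L1) → C ≤ A → t ≤ n := fun ht hC => ht.trans ((Nat.mul_le_mul_right _ hC).trans hX)
  have cst : ∀ C : ℕ, C ≤ C * (P * L1) := fun C => Nat.le_mul_of_pos_right C hPL
  -- the side conditions
  have h8 : 8 < n := by
    have : 9 ≤ n := dom (cst 9) (by rw [hA]; omega)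
    omega
  have hc2 : 4 * (c + 2) ≤ n := dom (cst (4 * (c + 2))) (by rw [hA]; omega)
  have hc3 : c + 7 ≤ n := dom (cst (c + 7)) (by rw [hA]; omega)
  have hk3 : k ^ 3 + 2 ≤ n := by
    refine dom (C := 3) ?_ (by rw [hA]; omega)
    calc k ^ 3 + 2 ≤ P + 2 * P := by omega
      _ = 3 * P := by ring
      _ ≤ 3 * (P * L1) := Nat.mul_le_mul_left _ hPPL
  have hchoose : (4 * k) * (n ^ c + c) < n.choose (c + 2) := by
    refine choose_gt_of_le (dom (C := 2 * c + 4 + 4 * M) ?_ (by rw [hA]; omega))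
    unfold chooseThreshold
    calc 2 * (c + 1) + 4 * k * (c + 2).factorial * 2 ^ c * (c + 1) + 2 = (2 * c + 4) + (4 * M) * k := by rw [hM]; ring
      _ ≤ (2 * c + 4) * (P * L1) + (4 * M) * (P * L1) := Nat.add_le_add (cst _) (Nat.mul_le_mul_left _ hkPL)
      _ = (2 * c + 4 + 4 * M) * (P * L1) := by ring
  -- clean representation
  have hsym' : ∀ σ τ : Perm (Fin n), mact σ τ f = f := fun σ τ => by rw [mact_apply]; exact hsym σ τ
  obtain ⟨R, hRm⟩ := exists_cleanRep (D := D) a L hL hcard hf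
  have hm3 : R.m ^ 3 + 2 ≤ n := le_trans (Nat.add_le_add_right (Nat.pow_le_pow_left hRm 3) 2) hk3
  -- the orbit datum
  set Θ : ℕ := (R.m - 1) * (29 * Rb R.m D) with hΘ
  let O : OrbitDatum n D :=
    { f := f, hsym := hsym', R := R, cl := orbitRep R, Θ := Θ,
      hdiam := fun i j hij => rdist_le_of_eqvGen hAI hsym' R h8 hm3 ((orbitRep_eq_iff R).1 hij),
      hfix := fun b σ τ hσ hτ => clusterSum_orbitRep_fixed hOC hsym' R b σ τ hσ hτ,
      hn8 := h8 }
  -- its side conditions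
  have hRb : Rb R.m D ≤ 12 * k ^ 2 * ((2 * c + 2) * L1) := by
    have h := rb_le_rbBound hRm c n
    unfold rbBound at h
    have hRbD : Rb R.m D = 3 * (2 * R.m) ^ 2 * (Nat.log 2 (2 * (n ^ c + c)) + 1) := rfl
    rw [hRbD]
    refine h.trans ?_
    have : (2 * c + 1) * L1 + 1 ≤ (2 * c + 2) * L1 :=
      calc (2 * c + 1) * L1 + 1 ≤ (2 * c + 1) * L1 + L1 := Nat.add_le_add_left hL1' _
        _ = (2 * c + 2) * L1 := by ring
    calc 3 * (2 * k) ^ 2 * ((2 * c + 1) * (Nat.log 2 n + 1) + 1) = 12 * k ^ 2 * ((2 * c + 1) * L1 + 1) := by rw [hL1]; ring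
      _ ≤ 12 * k ^ 2 * ((2 * c + 2) * L1) := Nat.mul_le_mul_left _ this
  have hΘle : Θ ≤ k * (29 * (12 * k ^ 2 * ((2 * c + 2) * L1))) := by
    rw [hΘ]
    exact Nat.mul_le_mul (le_trans (Nat.sub_le _ _) hRm) (Nat.mul_le_mul_left _ hRb)
  have hdim : 4 * (R.m * (1 + R.m ^ 2 * Θ)) + 8 ≤ n := by
    refine dom (C := 1392 * (2 * c + 2) + 12) ?_ (by rw [hA]; omega)
    have hm2 : R.m ^ 2 ≤ k ^ 2 := Nat.pow_le_pow_left hRm 2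
    have hstep1 : R.m * (1 + R.m ^ 2 * Θ) ≤ k * (1 + k ^ 2 * (k * (29 * (12 * k ^ 2 * ((2 * c + 2) * L1))))) :=
      Nat.mul_le_mul hRm (Nat.add_le_add_left (Nat.mul_le_mul hm2 hΘle) 1)
    have hP6 : k ^ 6 * L1 ≤ P * L1 := Nat.mul_le_mul_right _ hPk6
    calc 4 * (R.m * (1 + R.m ^ 2 * Θ)) + 8
        ≤ 4 * (k * (1 + k ^ 2 * (k * (29 * (12 * k ^ 2 * ((2 * c + 2) * L1)))))) + 8 :=
          Nat.add_le_add_right (Nat.mul_le_mul_left 4 hstep1) 8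
      _ = 4 * k + 1392 * (2 * c + 2) * (k ^ 6 * L1) + 8 := by ring
      _ ≤ 4 * (P * L1) + 1392 * (2 * c + 2) * (P * L1) + 8 * (P * L1) :=
          Nat.add_le_add (Nat.add_le_add (Nat.mul_le_mul_left 4 hkPL) (Nat.mul_le_mul_left _ hP6)) (cst 8)
      _ = (1392 * (2 * c + 2) + 12) * (P * L1) := by ring
  have hH : O.Hyps c :=
    { hc1 := by
        calc 4 * (R.m * D) ≤ 4 * (k * D) := Nat.mul_le_mul_left 4 (Nat.mul_le_mul_right D hRm)
          _ = (4 * k) * (n ^ c + c) := by rw [hD]; ring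
          _ < n.choose (c + 2) := hchoose
      hc2 := hc2, hc3 := hc3, hdim := hdim }
  -- the structure theorem at this level
  obtain ⟨u, Lin, Q, h1, h2, h3, h4⟩ := O.structure_level hH
  -- pad to `Fin k`
  refine ⟨fun j => if h : (j : ℕ) < R.m then u ⟨j, h⟩ else 0, fun j => if h : (j : ℕ) < R.m then Lin ⟨j, h⟩ else 0,
    fun j => if h : (j : ℕ) < R.m then Q ⟨j, h⟩ else 0, fun j q hq => ?_, fun j => ?_, fun j σ τ => ?_, ?_⟩
  · dsimp only at hq
    by_cases h : (j : ℕ) < R.m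
    · rw [dif_pos h] at hq; exact (h1 _ q hq).le
    · rw [dif_neg h] at hq; exact absurd hq (Multiset.notMem_zero q)
  · dsimp only
    by_cases h : (j : ℕ) < R.m
    · rw [dif_pos h]; exact h2 _
    · rw [dif_neg h]; simp
  · dsimp only
    by_cases h : (j : ℕ) < R.m
    · rw [dif_pos h, ← mact_apply]; exact h3 _ σ τ
    · rw [dif_neg h]; simp
  · have hval : ∀ i : Fin R.m, ((Fin.castLEEmb hRm i : Fin k) : ℕ) = i := fun i => rfl
    have hf4 : f = ∑ i : Fin R.m, C (u i) * (Lin i).prod * Polynomial.aeval (U n) (Q i) := h4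
    refine hf4.trans ?_
    symm
    rw [← Finset.sum_subset (Finset.subset_univ (Finset.univ.map (Fin.castLEEmb hRm))), Finset.sum_map]
    · refine Finset.sum_congr rfl fun i _ => ?_
      have h : ((Fin.castLEEmb hRm i : Fin k) : ℕ) < R.m := by rw [hval]; exact i.isLt
      have he : (⟨((Fin.castLEEmb hRm i : Fin k) : ℕ), h⟩ : Fin R.m) = i := Fin.ext (hval i)
      simp only [dif_pos h, he]
    · intro j _ hj
      have h : ¬ (j : ℕ) < R.m := fun h => hj (Finset.mem_map.2 ⟨⟨j, h⟩, Finset.mem_univ _, Fin.ext rfl⟩)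
      simp only [dif_neg h, C_0, zero_mul]

/-- **The line's Theorems-side reduction, assembled**: the NEW RUNG `GrowingFaninRestoration` from the two NAMED FACTS (product mixing in
`𝔄_n` — Literature `alternatingProductMixing`; the Saxena–Seshadhri rank bound — Literature `depthThree_rankBound`) and A₁
(`PiSigmaValue`, the OPEN `ΠΣ` sub-rung of the line of record), every other input discharged by a landed theorem (M2 `stub_almostInvariantTerms`,
M3 `stub_orbitClassSums`, M4a `essStableAlt`, M4b `spanOneUAlt`, M4c `stub_polyScaleStructure`, M5 `growingFanin`).  The rung
`ProductDepthRestorationQP (fun _ => 1)` follows only through the declared residual `GrowingFaninResidual`. [folklore] -/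
theorem growingFaninRestoration_of_facts (hmix : Literature.GroupTheory.QuasirandomGroups.alternatingProductMixing)
    (hRB : depthThree_rankBound) (hA1 : PiSigmaValue) : GrowingFaninRestoration :=
  growingFanin hRB hA1 (stub_polyScaleStructure hRB (stub_almostInvariantTerms hmix hRB) (stub_orbitClassSums hRB) essStableAlt spanOneUAlt)

end Summit.ValiantsHypothesis.ValiantsHypothesis.Theorems.OrbitRestorationQPMixingScale

end
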